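import Literature.AnabelianGeometry.SemiGraphs.TemperedReconstructionCor39Finite
import Literature.AnabelianGeometry.SemiGraphs.TemperedQuasiGeometricCompatible
import Literature.AnabelianGeometry.SemiGraphs.TemperedReconstructionReductions
import Literature.AnabelianGeometry.SemiGraphs.TemperedMaximalCompact
import HarnessLib

/-!
# [SemiAnbd] Cor. 3.9 at FINITE graphs, isomorphism version — I: vertices (proof-only)

Mochizuki, *Semi-graphs of anabelioids*, Publ. RIMS **42** (2006), §3, Cor. 3.9 pp. 42–43 ("a natural
bijective correspondence … functorial") as used in the proof of Cor. 3.11 p. 46: "by Corollary 3.9, we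
conclude that `γ` induces a natural, functorial isomorphism of graphs of anabelioids `G[α]_Σ ⥲ G[β]_Σ`"
[cite: MochizukiSemiAnbd2006, Cor 3.11 p.46].

PROOF-ONLY file (abc-iut cell, layer L3, sub-DAG SemiAnbd-Cor311, row «S3a-ISO», seat abc-iut-w4-d083;
L3-lead GO 2026-08-26T12:13:43Z), first of two.  For FINITE graphs of anabelioids `G`, `H` satisfying the
hypotheses of Cor. 3.9, charts `c_G`, `c_H`, an ISOMORPHISM `φ : π₁^temp(G) ⥲ π₁^temp(H)` of topological
groups and a morphism `F : G → H` compatible with `φ` on verticial homomorphisms (`Hom.CompatV`, what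
Cor. 3.9 (b) delivers):

* `IsMaximalCompactSubgroup.map_equiv` and the conjugation / transport bookkeeping `map_conj_map_conj`,
  `map_conj_map_equiv`, `map_symm_conj_map_equiv`, `map_symm_map_equiv`, `map_map_symm_equiv`;
* `map_range_eq_of_compatV` — `φ(ψ_v(Π_v)) = g · ψ_{F v}(Π_{F v}) · g⁻¹` (EQUALITY: both sides are
  maximal compact, Thm. 3.7 (iv) at the finite `G`); hence `hV_bijective_of_compatV_equiv` — every `F_v` is
  bijective (Thm. 3.7 (i));
* `vertexMap_bijective_of_compatV_equiv` — the vertex map of `F` is bijective (through the bijection `φ`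
  induces on verticial subgroups: Thm. 3.7 (ii), (iv) at both finite graphs, transported by `φ⁻¹`).

Edges and the assembly `isIso_of_compat_equiv_of_finite` are in `TemperedReconstructionCor39IsoFinite.lean`.
No definition; nothing here takes a side on [IUTchIII] Cor. 3.12.
-/

open CategoryTheory Topology

noncomputable section

namespace Literature.AnabelianGeometry.SemiGraphs

universe u

section Algebra

variable {A : Type u} [Group A] [TopologicalSpace A] {B : Type u} [Group B] [TopologicalSpace B]

/-- The image of a subgroup under an isomorphism of topological groups, as a set (Rmk. 3.8.1: transport
along an isomorphism). [cite: MochizukiSemiAnbd2006, Rmk 3.8.1 p.42] -/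
theorem coe_map_continuousMulEquiv (e : A ≃ₜ* B) (H : Subgroup A) :
    ((H.map e.toMonoidHom : Subgroup B) : Set B) = e.toHomeomorph '' (H : Set A) := by
  ext; simp

/-- An isomorphism of topological groups carries maximal compact subgroups to maximal compact subgroups
(Rmk. 3.8.1 "an isomorphism … is quasi-geometric"; public form of the private lemma of
`TemperedQuasiGeometricCompatible.lean`). [cite: MochizukiSemiAnbd2006, Rmk 3.8.1 p.42] -/
theorem IsMaximalCompactSubgroup.map_equiv (e : A ≃ₜ* B) {K : Subgroup A}
    (hK : IsMaximalCompactSubgroup K) : IsMaximalCompactSubgroup (K.map e.toMonoidHom) := by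
  refine ⟨?_, fun K' hK' hle => ?_⟩
  · rw [coe_map_continuousMulEquiv]; exact e.toHomeomorph.isCompact_image.mpr hK.1
  have hK'c : IsCompact ((K'.map e.symm.toMonoidHom : Subgroup A) : Set A) := by
    rw [coe_map_continuousMulEquiv]; exact e.symm.toHomeomorph.isCompact_image.mpr hK'
  have hle' : K ≤ K'.map e.symm.toMonoidHom := fun x hx =>
    ⟨e x, hle ⟨x, hx, rfl⟩, e.symm_apply_apply x⟩
  have heq := hK.2 _ hK'c hle'
  refine le_antisymm (fun y hy => ?_) hle
  have : e.symm y ∈ K := by rw [← heq]; exact ⟨y, hy, rfl⟩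
  exact ⟨e.symm y, this, e.apply_symm_apply y⟩

omit [TopologicalSpace A] in
/-- Iterated conjugation of a subgroup (bookkeeping for "well-defined up to conjugation", Cor. 3.9
proof p. 43). [cite: MochizukiSemiAnbd2006, Cor 3.9 p.43] -/
theorem map_conj_map_conj (H : Subgroup A) (a b : A) :
    (H.map (MulAut.conj b).toMonoidHom).map (MulAut.conj a).toMonoidHom =
      H.map (MulAut.conj (a * b)).toMonoidHom := by
  rw [Subgroup.map_map]
  congr 1
  ext x
  simp [mul_assoc]

/-- An isomorphism transports conjugation: `φ(a · H · a⁻¹) = φ(a) · φ(H) · φ(a)⁻¹` (bookkeeping, Cor. 3.9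
proof p. 43). [cite: MochizukiSemiAnbd2006, Cor 3.9 p.43] -/
theorem map_conj_map_equiv (φ : A ≃ₜ* B) (H : Subgroup A) (a : A) :
    (H.map (MulAut.conj a).toMonoidHom).map φ.toMonoidHom =
      (H.map φ.toMonoidHom).map (MulAut.conj (φ a)).toMonoidHom := by
  rw [Subgroup.map_map, Subgroup.map_map]
  congr 1
  ext x
  change φ (a * x * a⁻¹) = φ a * φ x * (φ a)⁻¹
  rw [map_mul, map_mul, map_inv]

/-- Transport of a conjugate back along `φ`: `φ⁻¹(a · φ(H) · a⁻¹) = φ⁻¹(a) · H · φ⁻¹(a)⁻¹` (bookkeeping,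
Cor. 3.9 proof p. 43). [cite: MochizukiSemiAnbd2006, Cor 3.9 p.43] -/
theorem map_symm_conj_map_equiv (φ : A ≃ₜ* B) (H : Subgroup A) (a : B) :
    ((H.map φ.toMonoidHom).map (MulAut.conj a).toMonoidHom).map φ.symm.toMonoidHom =
      H.map (MulAut.conj (φ.symm a)).toMonoidHom := by
  ext y
  constructor
  · rintro ⟨_, ⟨_, ⟨x, hx, rfl⟩, rfl⟩, rfl⟩
    refine ⟨x, hx, ?_⟩
    change φ.symm a * x * (φ.symm a)⁻¹ = φ.symm (a * φ x * a⁻¹)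
    rw [map_mul, map_mul, map_inv, φ.symm_apply_apply]
  · rintro ⟨x, hx, rfl⟩
    refine ⟨a * φ x * a⁻¹, ⟨φ x, ⟨x, hx, rfl⟩, rfl⟩, ?_⟩
    change φ.symm (a * φ x * a⁻¹) = φ.symm a * x * (φ.symm a)⁻¹
    rw [map_mul, map_mul, map_inv, φ.symm_apply_apply]

/-- `φ⁻¹ ∘ φ` on subgroups (bookkeeping, Cor. 3.9 proof p. 43). [cite: MochizukiSemiAnbd2006, Cor 3.9 p.43] -/
theorem map_symm_map_equiv (φ : A ≃ₜ* B) (H : Subgroup A) :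
    (H.map φ.toMonoidHom).map φ.symm.toMonoidHom = H := by
  rw [Subgroup.map_map]
  convert Subgroup.map_id H
  ext x
  exact φ.symm_apply_apply x

/-- `φ ∘ φ⁻¹` on subgroups (bookkeeping, Cor. 3.9 proof p. 43). [cite: MochizukiSemiAnbd2006, Cor 3.9 p.43] -/
theorem map_map_symm_equiv (φ : A ≃ₜ* B) (W : Subgroup B) :
    (W.map φ.symm.toMonoidHom).map φ.toMonoidHom = W := by
  rw [Subgroup.map_map]
  convert Subgroup.map_id W
  ext x
  exact φ.apply_symm_apply x

end Algebra

namespace ProfiniteSemiGraph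

variable {𝒢 ℋ : ProfiniteSemiGraph.{u}}

/-- **`φ(ψ_v(Π_v)) = g · ψ_{F v}(Π_{F v}) · g⁻¹`**: the compatibility inclusion is an equality, both sides
being maximal compact (Thm. 3.7 (iv) at the finite `G`; the right side is compact).
[cite: MochizukiSemiAnbd2006, Cor 3.9 p.43] -/
theorem map_range_eq_of_compatV [Finite 𝒢.graph.Vertex] [Finite 𝒢.graph.Edge]
    (h𝒢 : Cor39Hypotheses 𝒢) (c𝒢 : TemperedPiChart 𝒢) (cℋ : TemperedPiChart ℋ)
    (φ : c𝒢.G ≃ₜ* cℋ.G) (F : Hom 𝒢 ℋ) {v : 𝒢.graph.Vertex} {ψ : 𝒢.Gv v →ₜ* c𝒢.G}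
    {ψ' : ℋ.Gv (F.base.vertexMap v) →ₜ* cℋ.G} (hψ : IsVerticialHom c𝒢 v ψ)
    (hψ' : IsVerticialHom cℋ (F.base.vertexMap v) ψ') {g : cℋ.G}
    (hg : ∀ x, φ (ψ x) = g * ψ' (F.hV v x) * g⁻¹) :
    ψ.toMonoidHom.range.map φ.toMonoidHom = ψ'.toMonoidHom.range.map (MulAut.conj g).toMonoidHom := by
  have hK : ψ.toMonoidHom.range ∈ verticialSubgroups c𝒢 v := ⟨ψ, hψ, rfl⟩
  have hmax : IsMaximalCompactSubgroup (ψ.toMonoidHom.range.map φ.toMonoidHom) :=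
    IsMaximalCompactSubgroup.map_equiv φ
      (((maximalCompactIffVerticialAt_of_finiteGraph h𝒢.thm37Hypotheses c𝒢).1 _).mpr ⟨v, hK⟩)
  have hW : ψ'.toMonoidHom.range.map (MulAut.conj g).toMonoidHom ∈
      verticialSubgroups cℋ (F.base.vertexMap v) :=
    conj_mem_verticialSubgroups cℋ ⟨ψ', hψ', rfl⟩ g
  have hle : ψ.toMonoidHom.range.map φ.toMonoidHom ≤
      ψ'.toMonoidHom.range.map (MulAut.conj g).toMonoidHom := by
    rintro _ ⟨_, ⟨x, rfl⟩, rfl⟩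
    exact ⟨ψ' (F.hV v x), ⟨F.hV v x, rfl⟩, (hg x).symm⟩
  exact (hmax.2 _ (isCompact_of_mem_verticialSubgroups cℋ hW) hle).symm

/-- **The vertex homomorphisms `F_v` are bijective** (for `F` locally open and compatible on verticial
homomorphisms with an isomorphism `φ`, at a finite `G`). [cite: MochizukiSemiAnbd2006, Cor 3.11 p.46] -/
theorem hV_bijective_of_compatV_equiv [Finite 𝒢.graph.Vertex] [Finite 𝒢.graph.Edge]
    (h𝒢 : Cor39Hypotheses 𝒢) (hℋ : Cor39Hypotheses ℋ) (c𝒢 : TemperedPiChart 𝒢) (cℋ : TemperedPiChart ℋ)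
    (φ : c𝒢.G ≃ₜ* cℋ.G) (F : Hom 𝒢 ℋ) (hV : F.CompatV c𝒢 cℋ (φ : c𝒢.G →ₜ* cℋ.G))
    (v : 𝒢.graph.Vertex) : Function.Bijective (F.hV v) := by
  have h37i := verticialInjective_holds.{u}
  obtain ⟨⟨_, ψ, hψ, rfl⟩, hinj⟩ := h37i 𝒢 h𝒢.thm37Hypotheses c𝒢 v
  obtain ⟨⟨_, ψ', hψ', rfl⟩, hinj'⟩ := h37i ℋ hℋ.thm37Hypotheses cℋ (F.base.vertexMap v)
  obtain ⟨g, hg⟩ := hV v ψ ψ' hψ hψ'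
  have hg' : ∀ x, φ (ψ x) = g * ψ' (F.hV v x) * g⁻¹ := fun x => hg x
  refine ⟨fun x y hxy => hinj ψ hψ ?_, fun y => ?_⟩
  · apply φ.injective
    rw [hg' x, hg' y, hxy]
  · have hmem : g * ψ' y * g⁻¹ ∈ ψ'.toMonoidHom.range.map (MulAut.conj g).toMonoidHom :=
      ⟨ψ' y, ⟨y, rfl⟩, rfl⟩
    rw [← map_range_eq_of_compatV h𝒢 c𝒢 cℋ φ F hψ hψ' hg'] at hmem
    obtain ⟨_, ⟨x, rfl⟩, hx⟩ := hmem
    refine ⟨x, hinj' ψ' hψ' ?_⟩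
    have h1 : φ (ψ x) = g * ψ' y * g⁻¹ := hx
    rw [hg' x] at h1
    exact mul_left_cancel (mul_right_cancel h1)

/-- **The vertex map of `F` is bijective** (through the bijection `φ` induces on verticial subgroups,
Thm. 3.7 (ii), (iv) at the finite graphs). [cite: MochizukiSemiAnbd2006, Cor 3.11 p.46] -/
theorem vertexMap_bijective_of_compatV_equiv [Finite 𝒢.graph.Vertex] [Finite 𝒢.graph.Edge]
    [Finite ℋ.graph.Vertex] [Finite ℋ.graph.Edge]
    (h𝒢 : Cor39Hypotheses 𝒢) (hℋ : Cor39Hypotheses ℋ) (c𝒢 : TemperedPiChart 𝒢) (cℋ : TemperedPiChart ℋ)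
    (φ : c𝒢.G ≃ₜ* cℋ.G) (F : Hom 𝒢 ℋ) (hV : F.CompatV c𝒢 cℋ (φ : c𝒢.G →ₜ* cℋ.G)) :
    Function.Bijective F.base.vertexMap := by
  have h37i := verticialInjective_holds.{u}
  have h37ii := verticialDistinct_holds.{u}
  have h𝒢37 := h𝒢.thm37Hypotheses
  have hℋ37 := hℋ.thm37Hypotheses
  refine ⟨fun v v' hvv => ?_, fun w => ?_⟩
  · obtain ⟨⟨_, ψ, hψ, rfl⟩, -⟩ := h37i 𝒢 h𝒢37 c𝒢 v
    obtain ⟨⟨_, ψ₁, hψ₁, rfl⟩, -⟩ := h37i 𝒢 h𝒢37 c𝒢 v'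
    obtain ⟨⟨_, ψ', hψ', rfl⟩, -⟩ := h37i ℋ hℋ37 cℋ (F.base.vertexMap v)
    obtain ⟨⟨_, ψ'₁, hψ'₁, rfl⟩, -⟩ := h37i ℋ hℋ37 cℋ (F.base.vertexMap v')
    obtain ⟨g, hg⟩ := hV v ψ ψ' hψ hψ'
    obtain ⟨g₁, hg₁⟩ := hV v' ψ₁ ψ'₁ hψ₁ hψ'₁
    have h1 := map_range_eq_of_compatV h𝒢 c𝒢 cℋ φ F hψ hψ' (fun x => hg x)
    have h2 := map_range_eq_of_compatV h𝒢 c𝒢 cℋ φ F hψ₁ hψ'₁ (fun x => hg₁ x)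
    -- the two target verticial subgroups sit at the same vertex, hence are conjugate
    have hmem : ψ'₁.toMonoidHom.range ∈ verticialSubgroups cℋ (F.base.vertexMap v) := by
      rw [hvv]; exact ⟨ψ'₁, hψ'₁, rfl⟩
    obtain ⟨b, hb⟩ := exists_conj_of_mem_verticialSubgroups cℋ ⟨ψ', hψ', rfl⟩ hmem
    -- `φ(K_{v'}) = (g₁ b g⁻¹) · φ(K_v) · (g₁ b g⁻¹)⁻¹`
    have h3 : ψ₁.toMonoidHom.range.map φ.toMonoidHom =
        (ψ.toMonoidHom.range.map φ.toMonoidHom).map (MulAut.conj (g₁ * b * g⁻¹)).toMonoidHom := by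
      rw [h1, h2, hb, map_conj_map_conj, map_conj_map_conj]
      congr 2
      group
    -- pull back along `φ⁻¹`: `K_{v'}` is a conjugate of `K_v`, hence verticial at `v`
    have h4 : ψ₁.toMonoidHom.range =
        ψ.toMonoidHom.range.map (MulAut.conj (φ.symm (g₁ * b * g⁻¹))).toMonoidHom := by
      have := congrArg (Subgroup.map φ.symm.toMonoidHom) h3
      rwa [map_symm_map_equiv, map_symm_conj_map_equiv] at this
    have hK₁v : ψ₁.toMonoidHom.range ∈ verticialSubgroups c𝒢 v := by
      rw [h4]; exact conj_mem_verticialSubgroups c𝒢 ⟨ψ, hψ, rfl⟩ _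
    have hK₁v' : ψ₁.toMonoidHom.range ∈ verticialSubgroups c𝒢 v' := ⟨ψ₁, hψ₁, rfl⟩
    by_contra hne
    have h0 := (h37ii 𝒢 h𝒢37 c𝒢).1 v v' _ _ hK₁v hK₁v' hne
    rw [Subgroup.relIndex_self] at h0
    exact one_ne_zero h0
  · obtain ⟨⟨_, ψ', hψ', rfl⟩, -⟩ := h37i ℋ hℋ37 cℋ w
    have hKw : ψ'.toMonoidHom.range ∈ verticialSubgroups cℋ w := ⟨ψ', hψ', rfl⟩
    -- `φ⁻¹(K_w)` is maximal compact, hence verticial at some `v`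
    have hmax : IsMaximalCompactSubgroup (ψ'.toMonoidHom.range.map φ.symm.toMonoidHom) :=
      IsMaximalCompactSubgroup.map_equiv φ.symm
        (((maximalCompactIffVerticialAt_of_finiteGraph hℋ37 cℋ).1 _).mpr ⟨w, hKw⟩)
    obtain ⟨v, hv⟩ := ((maximalCompactIffVerticialAt_of_finiteGraph h𝒢37 c𝒢).1 _).mp hmax
    obtain ⟨⟨_, ψ, hψ, rfl⟩, -⟩ := h37i 𝒢 h𝒢37 c𝒢 v
    obtain ⟨⟨_, ψ₁, hψ₁, rfl⟩, -⟩ := h37i ℋ hℋ37 cℋ (F.base.vertexMap v)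
    obtain ⟨g, hg⟩ := hV v ψ ψ₁ hψ hψ₁
    have h1 := map_range_eq_of_compatV h𝒢 c𝒢 cℋ φ F hψ hψ₁ (fun x => hg x)
    -- `φ⁻¹(K_w) = a · K_v · a⁻¹`
    obtain ⟨a, ha⟩ := exists_conj_of_mem_verticialSubgroups c𝒢 ⟨ψ, hψ, rfl⟩ hv
    -- so `K_w = (φ(a) g) · K_{F v} · (φ(a) g)⁻¹` is verticial at `F v`
    have h2 : ψ'.toMonoidHom.range =
        ψ₁.toMonoidHom.range.map (MulAut.conj (φ a * g)).toMonoidHom := by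
      rw [← map_map_symm_equiv φ ψ'.toMonoidHom.range, ha, map_conj_map_equiv, h1, map_conj_map_conj]
    have hKw' : ψ'.toMonoidHom.range ∈ verticialSubgroups cℋ (F.base.vertexMap v) := by
      rw [h2]; exact conj_mem_verticialSubgroups cℋ ⟨ψ₁, hψ₁, rfl⟩ _
    refine ⟨v, ?_⟩
    by_contra hne
    have h0 := (h37ii ℋ hℋ37 cℋ).1 _ _ _ _ hKw' hKw hne
    rw [Subgroup.relIndex_self] at h0
    exact one_ne_zero h0

end ProfiniteSemiGraph

end Literature.AnabelianGeometry.SemiGraphs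

end
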